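import Summits.QuantumFields.YangMills.Theorems.SusceptibilityToPoincare.Negative.FalseOfFiniteSusceptibilityMetastableFamily
import Literature.MathematicalPhysics.QuantumFieldTheory.TwistSectorInputs
import HarnessLib

/-!
# `SusceptibilityToPoincare` — the hierarchy of standing negative inputs, kernel-checked

Crux `stmt-QuantumFields-9441` (`Summit.QuantumFields.YangMills.Theses.FradkinShenkerFlow.SusceptibilityToPoincare`:
for every compact simple `G`, every faithful unitary lattice representation `r`, every `β ≥ 0`, finite gauge-invariant
susceptibility uniformly in the torus side (FS) ⇒ a volume-uniform single-link heat-bath Poincaré inequality (UP)).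
Lead c11 (sixteenth lead seat), negative side.

Two hypothesis bundles refute the crux AS TYPED: 't Hooft's twist-sector inputs in WINDOW form
(`Literature.MathematicalPhysics.QuantumFieldTheory.TwistSectorInputs`: centreless `G`, gauge-invariant events of Wilson mass in
`[δ, 1 − δ]`, ABSOLUTE heat-bath flux `→ 0`; negative lemma p76563) and the METASTABLE bundle
(`Negative.FiniteSusceptibilityMetastableFamily`: positive mass `≤ 1 − δ`, CONDITIONAL flux `→ 0`; negative lemma p141393).
This file proves, once and for all in the tree, that the window bundle implies the metastable bundle
(`finiteSusceptibilityMetastableFamily_of_twistSectorInputs`: mass `≥ δ > 0` is positive, and conditional flux `≤` absolute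
flux `/ δ → 0`), so the metastable bundle is the WEAKEST standing input (p141393's lemma is the one an inhabitant of either
bundle feeds); and it re-derives the window negative lemma through the metastable one
(`Hold.SusceptibilityToPoincare_false_of_TwistSectorInputs`), filed with `--negative-modulo TwistSectorInputs` so that the
typed item is HELD on its conditional refutation (the fifteen earlier lead seats and the strategist concur: the typed decl
is `CoreSC ∧ T`, `Restatement.crux_iff_coreSC_and_residual` p127070, with `T` refuted modulo these inputs; repair
C″ = `SusceptibilityToPoincareSC`). Nothing here asserts a Theses statement or an open bundle unconditionally.
-/

noncomputable section

namespace Summit.QuantumFields.YangMills.Theorems.SusceptibilityToPoincare.Negative.Hold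

open MeasureTheory ProbabilityTheory Filter Topology
open Literature.MathematicalPhysics.QuantumFieldTheory

/-- **The window bundle implies the metastable bundle**: 't Hooft's twist-sector inputs
(`TwistSectorInputs`: FS at some admissible centreless `(G, r, β ≥ 0)` with gauge-invariant events of Wilson mass in
`[δ, 1 − δ]` and absolute single-link heat-bath flux `→ 0`) give a finite-susceptibility metastable family
(`FiniteSusceptibilityMetastableFamily`): the same `(G, r, β, δ, A)`; the mass is `≥ δ > 0`, and the conditional flux is at
most the absolute flux divided by `δ`, which tends to `0`. [folklore] -/
theorem finiteSusceptibilityMetastableFamily_of_twistSectorInputs (h : TwistSectorInputs) :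
    FiniteSusceptibilityMetastableFamily := by
  obtain ⟨G, iG, iT, iTG, iC, iM, iB, hsimple, -, r, β, hβ, hfs, δ, hδ, A, hmeas, -, hmass, hflux⟩ := h
  refine ⟨G, iG, iT, iTG, iC, iM, iB, hsimple, r, β, hβ, hfs, δ, hδ, A, hmeas,
    fun S => ⟨lt_of_lt_of_le hδ (hmass S).1, (hmass S).2⟩, ?_⟩
  -- the absolute flux sequence
  set Φ : ℕ → ℝ := fun S : ℕ => ∑ ℓ : Edge 4 (2 * S + 1), ∫ U, ∫ g,
      ((A S).indicator (1 : GaugeConfig 4 (2 * S + 1) G → ℝ) U -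
        (A S).indicator 1 (Function.update U ℓ g)) ^ 2
      ∂((haarProbability G).tilted (fun g' => -β * wilsonAction r.ρ (Function.update U ℓ g')))
      ∂(wilsonMeasure (d := 4) (L := 2 * S + 1) r.ρ β) with hΦ
  have hΦ_nonneg : ∀ S, 0 ≤ Φ S := fun S =>
    Finset.sum_nonneg fun _ _ => integral_nonneg fun _ => integral_nonneg fun _ => sq_nonneg _
  have hupper : Tendsto (fun S => Φ S / δ) atTop (𝓝 0) := by
    simpa using hflux.div_const δ
  refine tendsto_of_tendsto_of_tendsto_of_le_of_le tendsto_const_nhds hupper (fun S => ?_) (fun S => ?_)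
  · exact div_nonneg (hΦ_nonneg S) (le_of_lt (lt_of_lt_of_le hδ (hmass S).1))
  · exact div_le_div_of_nonneg_left (hΦ_nonneg S) hδ (hmass S).1

/-- **`¬ SusceptibilityToPoincare` modulo `TwistSectorInputs`, through the metastable bundle** (negative lemma for the
`--negative-modulo` hold; same content as p76563's `Negative.SusceptibilityToPoincare_false_of_TwistSectorInputs`, re-derived as
window bundle ⇒ metastable bundle ⇒ ¬ crux). Class when inhabited: refuted-misstated, repair C″ = `SusceptibilityToPoincareSC`
(simply connected `G`, `β ≥ β₁(r)`), which the intended SO(3) weak-coupling witness misses. [folklore] -/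
theorem SusceptibilityToPoincare_false_of_TwistSectorInputs (h : TwistSectorInputs) :
    ¬ Summit.QuantumFields.YangMills.Theses.FradkinShenkerFlow.SusceptibilityToPoincare :=
  SusceptibilityToPoincare_false_of_FiniteSusceptibilityMetastableFamily
    (finiteSusceptibilityMetastableFamily_of_twistSectorInputs h)

end Summit.QuantumFields.YangMills.Theorems.SusceptibilityToPoincare.Negative.Hold
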